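import Mathlib
import Summits.MatrixMultiplication.MatrixMultiplication.Theorems.FidelityWitnessesFidelityThesisSepMajorantSingleProduct

/-!
# Line `separable-majorant` for crux `FidelityWitnesses.FidelityThesis` (stmt-MatrixMultiplication-4956) —
stub `stub_spectralSplitLaw`: the SPECTRAL SPLIT LAW (card law (3))

Conventions (tree `matMulTensor`): slots `a = (κ,ν)` (output), `b = (κ,μ)`, `c = (μ',ν)` in `Fin n × Fin n`,
`⟨n,n,n⟩(a,b,c) = [a.1 = b.1 ∧ b.2 = c.1 ∧ a.2 = c.2]`, output slices `T_a := ⟨n,n,n⟩(a,·,·)`, and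
`⟨x, y⟩ = Σ_{b,c} conj x · y` on `ℂ^P ⊗ ℂ^P`, `P = Fin n × Fin n`.

Statement.  Let `S = Σ_{l<r} w_l ⊗ u_l ⊗ v_l`, `N_l := ‖u_l‖² ‖v_l‖²`, and suppose the input products
`x_l = u_l ⊗ v_l` lie in the span of an orthonormal system `e_1, …, e_{d₁}, f_1, …, f_{d₂}` such that the
normalised frame operator `F = Σ_l |x_l⟩⟨x_l| / N_l` dominates `τ > 0` on `E₁ = span e` in vector form,
`τ · Σ_s |⟨e_s, y⟩|² ≤ Σ_l |⟨x_l, y⟩|² / N_l` for all `y` (in applications `E₁ ⊕ E₂`, `E₂ = span f`, is the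
spectral split of `F` at threshold `τ`).  Then

  `|⟨S, ⟨n,n,n⟩⟩|² ≤ (r/τ + n·d₂) · ‖S‖²`,

interpolating the frame conditioning law (`d₂ = 0`) and the flattening witness (`d₁ = 0`).

Proof.  Package the two families into one orthonormal frame `g` indexed by `Fin d₁ ⊕ Fin d₂`.  The output
slices `y_a = Σ_l w_l(a) x_l` expand as `y_a = Σ_i C_{a,i} g_i`, so slice by slice
`⟨S, ⟨n,n,n⟩⟩ = Σ_a Σ_i C_{a,i} ζ_{i,a}` with `ζ_{i,a} = ⟨ḡ_i, T_a⟩`, `‖S‖² = Σ_a Σ_i |C_{a,i}|²` (Parseval), and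
Cauchy–Schwarz over `(a, i)` gives `|⟨S,⟨n,n,n⟩⟩|² ≤ ‖S‖² · (cap e + cap f)`,
`cap e = Σ_{a,s} |⟨ē_s, T_a⟩|²`, `cap f = Σ_{a,t} |⟨f̄_t, T_a⟩|²`.
* `cap f ≤ n · d₂`: `⟨f̄_t, T_a⟩ = Σ_m f_t (a.1,m) (m,a.2)` (`sepMajorant_slice_sum_matMulTensor`), so by
  Cauchy–Schwarz `Σ_a |⟨f̄_t, T_a⟩|² ≤ n Σ_a Σ_m |f_t (a.1,m) (m,a.2)|² ≤ n ‖f_t‖² = n` (the slots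
  `((a.1,m),(m,a.2))` are distinct — the flattening count).
* `cap e ≤ r / τ`: `T_a` is real, so `|⟨ē_s, T_a⟩| = |⟨e_s, T_a⟩|`; the domination hypothesis at `y = T_a`,
  summed over `a`, gives `τ · cap e ≤ Σ_l (Σ_a |⟨x_l, T_a⟩|²) / N_l ≤ Σ_l 1 = r` by the single-product law
  (`sepMajorant_singleProductLaw`, toolkit I) applied to `conj u_l ⊗ conj v_l`.
Idea card `Cruxes/FidelityThesis/Ideas/separable-majorant-law.md`, law (3) (spectral split / collapse
count).  Supports item `stmt-MatrixMultiplication-4956`; no definitions; imports toolkit I only.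
-/

namespace Summit.MatrixMultiplication.MatrixMultiplication.Theorems

open scoped BigOperators ComplexConjugate
open Literature.Computability.AlgebraicComplexity

/-! #### The joint frame `g = (e, f)` indexed by `Fin d₁ ⊕ Fin d₂` -/

/-- Two orthonormal families `e` (`d₁` vectors) and `f` (`d₂` vectors) of `ℂ^{n×n} ⊗ ℂ^{n×n}` that are
mutually orthogonal (`⟨e_s, f_t⟩ = 0`) form one orthonormal family `g` indexed by `Fin d₁ ⊕ Fin d₂`
(for `⟨x, y⟩ = Σ conj x · y`; the missing relation `⟨f_t, e_s⟩ = conj ⟨e_s, f_t⟩ = 0`). [folklore] -/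
theorem sepMajorantSSL_jointFrame_orthonormal {n d₁ d₂ : ℕ}
    (e : Fin d₁ → (Fin n × Fin n) → (Fin n × Fin n) → ℂ)
    (f : Fin d₂ → (Fin n × Fin n) → (Fin n × Fin n) → ℂ)
    (g : Fin d₁ ⊕ Fin d₂ → (Fin n × Fin n) → (Fin n × Fin n) → ℂ)
    (hge : ∀ s, g (Sum.inl s) = e s) (hgf : ∀ t, g (Sum.inr t) = f t)
    (he : ∀ s t : Fin d₁, (∑ b, ∑ c, conj (e s b c) * e t b c) = if s = t then 1 else 0)
    (hf : ∀ s t : Fin d₂, (∑ b, ∑ c, conj (f s b c) * f t b c) = if s = t then 1 else 0)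
    (hef : ∀ (s : Fin d₁) (t : Fin d₂), (∑ b, ∑ c, conj (e s b c) * f t b c) = 0)
    (i j : Fin d₁ ⊕ Fin d₂) :
    (∑ b, ∑ c, conj (g i b c) * g j b c) = if i = j then 1 else 0 := by
  rcases i with s | t <;> rcases j with s' | t'
  · simp only [hge]
    rw [he s s']
    simp
  · simp only [hge, hgf]
    rw [hef s t']
    simp
  · simp only [hge, hgf]
    have hconj : (∑ b, ∑ c, conj (f t b c) * e s' b c) =
        conj (∑ b, ∑ c, conj (e s' b c) * f t b c) := by
      rw [map_sum]
      refine Finset.sum_congr rfl fun b _ => ?_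
      rw [map_sum]
      refine Finset.sum_congr rfl fun c _ => ?_
      rw [map_mul, Complex.conj_conj, mul_comm]
    rw [hconj, hef s' t, map_zero]
    simp
  · simp only [hgf]
    rw [hf t t']
    simp

/-- Moving a sum over the joint-frame index `i : Fin d₁ ⊕ Fin d₂` out of a double slot sum. [folklore] -/
theorem sepMajorantSSL_slot_sum_comm {n d₁ d₂ : ℕ}
    (Z : (Fin n × Fin n) → (Fin n × Fin n) → Fin d₁ ⊕ Fin d₂ → ℂ) :
    ∑ b, ∑ c, ∑ i, Z b c i = ∑ i, ∑ b, ∑ c, Z b c i := by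
  -- adapted from `slot_sum_comm_frame` (Cruxes/DiagonalPowerDecay/Lines/frame_negativity_singlet_fraction)
  calc ∑ b, ∑ c, ∑ i, Z b c i = ∑ b, ∑ i, ∑ c, Z b c i :=
        Finset.sum_congr rfl fun b _ => Finset.sum_comm
    _ = ∑ i, ∑ b, ∑ c, Z b c i := Finset.sum_comm

/-- Pairing a vector of the span of the joint frame against an arbitrary `z`:
if `F = Σ_i γ_i g_i` then `Σ_{b,c} F z = Σ_i γ_i · Σ_{b,c} g_i z`. [folklore] -/
theorem sepMajorantSSL_frame_pairing {n d₁ d₂ : ℕ}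
    (g : Fin d₁ ⊕ Fin d₂ → (Fin n × Fin n) → (Fin n × Fin n) → ℂ) (γ : Fin d₁ ⊕ Fin d₂ → ℂ)
    (F z : (Fin n × Fin n) → (Fin n × Fin n) → ℂ) (hF : ∀ b c, F b c = ∑ i, γ i * g i b c) :
    ∑ b, ∑ c, F b c * z b c = ∑ i, γ i * ∑ b, ∑ c, g i b c * z b c := by
  -- adapted from `sepMajorantTM_frame_pairing` (this line's stub `stub_trivialMajorant`)
  calc ∑ b, ∑ c, F b c * z b c
      = ∑ b, ∑ c, ∑ i, γ i * (g i b c * z b c) := by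
        refine Finset.sum_congr rfl fun b _ => Finset.sum_congr rfl fun c _ => ?_
        rw [hF b c, Finset.sum_mul]
        exact Finset.sum_congr rfl fun i _ => by ring
    _ = ∑ i, γ i * ∑ b, ∑ c, g i b c * z b c := by
        rw [sepMajorantSSL_slot_sum_comm]
        refine Finset.sum_congr rfl fun i _ => ?_
        rw [Finset.mul_sum]
        exact Finset.sum_congr rfl fun b _ => by rw [Finset.mul_sum]

/-- Coefficient identification in an orthonormal joint frame `g_i`, `i : Fin d₁ ⊕ Fin d₂`, of
`ℂ^{n×n} ⊗ ℂ^{n×n}` (for `⟨x, y⟩ = Σ conj x · y`): if `F = Σ_i γ_i g_i` then `⟨g_i, F⟩ = γ_i`. [folklore] -/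
theorem sepMajorantSSL_frame_coefficient {n d₁ d₂ : ℕ}
    (g : Fin d₁ ⊕ Fin d₂ → (Fin n × Fin n) → (Fin n × Fin n) → ℂ)
    (hg : ∀ i j, (∑ b, ∑ c, conj (g i b c) * g j b c) = if i = j then 1 else 0)
    (γ : Fin d₁ ⊕ Fin d₂ → ℂ) (F : (Fin n × Fin n) → (Fin n × Fin n) → ℂ)
    (hF : ∀ b c, F b c = ∑ i, γ i * g i b c) (i : Fin d₁ ⊕ Fin d₂) :
    ∑ b, ∑ c, conj (g i b c) * F b c = γ i := by
  -- adapted from `inner_frame_slice` (Cruxes/DiagonalPowerDecay/Lines/frame_negativity_singlet_fraction)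
  calc ∑ b, ∑ c, conj (g i b c) * F b c
      = ∑ b, ∑ c, ∑ j, γ j * (conj (g i b c) * g j b c) := by
        refine Finset.sum_congr rfl fun b _ => Finset.sum_congr rfl fun c _ => ?_
        rw [hF b c, Finset.mul_sum]
        exact Finset.sum_congr rfl fun j _ => by ring
    _ = ∑ j, γ j * ∑ b, ∑ c, conj (g i b c) * g j b c := by
        rw [sepMajorantSSL_slot_sum_comm]
        refine Finset.sum_congr rfl fun j _ => ?_
        rw [Finset.mul_sum]
        exact Finset.sum_congr rfl fun b _ => by rw [Finset.mul_sum]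
    _ = ∑ j, γ j * (if i = j then 1 else 0) := by
        refine Finset.sum_congr rfl fun j _ => ?_
        rw [hg i j]
    _ = γ i := by simp

/-- Parseval in an orthonormal joint frame `g_i`, `i : Fin d₁ ⊕ Fin d₂`, of `ℂ^{n×n} ⊗ ℂ^{n×n}`:
if `F = Σ_i γ_i g_i` then `Σ_{b,c} |F b c|² = Σ_i |γ_i|²`. [folklore] -/
theorem sepMajorantSSL_parseval {n d₁ d₂ : ℕ}
    (g : Fin d₁ ⊕ Fin d₂ → (Fin n × Fin n) → (Fin n × Fin n) → ℂ)
    (hg : ∀ i j, (∑ b, ∑ c, conj (g i b c) * g j b c) = if i = j then 1 else 0)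
    (γ : Fin d₁ ⊕ Fin d₂ → ℂ) (F : (Fin n × Fin n) → (Fin n × Fin n) → ℂ)
    (hF : ∀ b c, F b c = ∑ i, γ i * g i b c) :
    ∑ b, ∑ c, ‖F b c‖ ^ 2 = ∑ i, ‖γ i‖ ^ 2 := by
  -- adapted from `parseval_slice` (Cruxes/DiagonalPowerDecay/Lines/frame_negativity_singlet_fraction)
  have hFc : ∀ b c, conj (F b c) = ∑ i, conj (γ i) * conj (g i b c) := by
    intro b c
    rw [hF b c, map_sum]
    exact Finset.sum_congr rfl fun i _ => by rw [map_mul]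
  have hC : (∑ b, ∑ c, conj (F b c) * F b c) = ∑ i, conj (γ i) * γ i := by
    calc ∑ b, ∑ c, conj (F b c) * F b c
        = ∑ b, ∑ c, ∑ i, conj (γ i) * (conj (g i b c) * F b c) := by
          refine Finset.sum_congr rfl fun b _ => Finset.sum_congr rfl fun c _ => ?_
          rw [hFc b c, Finset.sum_mul]
          exact Finset.sum_congr rfl fun i _ => by ring
      _ = ∑ i, conj (γ i) * ∑ b, ∑ c, conj (g i b c) * F b c := by
          rw [sepMajorantSSL_slot_sum_comm]
          refine Finset.sum_congr rfl fun i _ => ?_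
          rw [Finset.mul_sum]
          exact Finset.sum_congr rfl fun b _ => by rw [Finset.mul_sum]
      _ = ∑ i, conj (γ i) * γ i :=
          Finset.sum_congr rfl fun i _ => by rw [sepMajorantSSL_frame_coefficient g hg γ F hF i]
  simp_rw [Complex.conj_mul'] at hC
  exact_mod_cast hC

/-- Cauchy–Schwarz over the pair index `(a, i)`, `a : Fin n × Fin n` an output slot and `i : Fin d₁ ⊕ Fin d₂`
a joint-frame index: `|Σ_{a,i} C Z|² ≤ (Σ_{a,i} |C|²) (Σ_{a,i} |Z|²)`. [folklore] -/
theorem sepMajorantSSL_cauchySchwarz_pair {n d₁ d₂ : ℕ}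
    (C Z : (Fin n × Fin n) → Fin d₁ ⊕ Fin d₂ → ℂ) :
    ‖∑ a, ∑ i, C a i * Z a i‖ ^ 2 ≤ (∑ a, ∑ i, ‖C a i‖ ^ 2) * ∑ a, ∑ i, ‖Z a i‖ ^ 2 := by
  -- adapted from `norm_sum_sum_mul_sq_le` (Cruxes/DiagonalPowerDecay/Lines/frame_negativity_singlet_fraction)
  have h := sepMajorant_cauchySchwarz (fun p : (Fin n × Fin n) × (Fin d₁ ⊕ Fin d₂) => C p.1 p.2)
    (fun p => Z p.1 p.2)
  rw [Fintype.sum_prod_type (f := fun p : (Fin n × Fin n) × (Fin d₁ ⊕ Fin d₂) => C p.1 p.2 * Z p.1 p.2),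
    Fintype.sum_prod_type (f := fun p : (Fin n × Fin n) × (Fin d₁ ⊕ Fin d₂) => ‖C p.1 p.2‖ ^ 2),
    Fintype.sum_prod_type (f := fun p : (Fin n × Fin n) × (Fin d₁ ⊕ Fin d₂) => ‖Z p.1 p.2‖ ^ 2)] at h
  exact h

/-! #### The two capacities: `cap f ≤ n·d₂` (flattening count) and `cap e ≤ r/τ` (domination) -/

/-- **Flattening count, slice form.**  For every `F ∈ ℂ^{n×n} ⊗ ℂ^{n×n}`,
`Σ_a |Σ_{b,c} F(b,c) ⟨n,n,n⟩(a,b,c)|² = Σ_a |Σ_m F (a.1,m) (m,a.2)|² ≤ n · ‖F‖²`: Cauchy–Schwarz over the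
`n` summands of each slice, and the slots `((a.1,m),(m,a.2))` are pairwise distinct. [folklore] -/
theorem sepMajorantSSL_sliceCapture_le {n : ℕ} (F : (Fin n × Fin n) → (Fin n × Fin n) → ℂ) :
    ∑ a : Fin n × Fin n, ‖∑ b, ∑ c, F b c * matMulTensor ℂ n n n a b c‖ ^ 2 ≤
      (n : ℝ) * ∑ b, ∑ c, ‖F b c‖ ^ 2 := by
  -- each slice: `|Σ_m F (a.1,m) (m,a.2)|² ≤ n · Σ_m |F (a.1,m) (m,a.2)|²` (Cauchy–Schwarz against `1`)
  have hrow : ∀ a : Fin n × Fin n, ‖∑ b, ∑ c, F b c * matMulTensor ℂ n n n a b c‖ ^ 2 ≤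
      (n : ℝ) * ∑ m : Fin n, ‖F (a.1, m) (m, a.2)‖ ^ 2 := by
    intro a
    rw [sepMajorant_slice_sum_matMulTensor F a]
    have h := sepMajorant_cauchySchwarz (fun _ : Fin n => (1 : ℂ)) (fun m => F (a.1, m) (m, a.2))
    simp only [one_mul, norm_one, one_pow, Finset.sum_const, Finset.card_univ, Fintype.card_fin,
      nsmul_eq_mul, mul_one] at h
    exact h
  -- the diagonal count: `Σ_a Σ_m |F (a.1,m) (m,a.2)|² ≤ ‖F‖²` (drop the slots `b.2 ≠ c.1`)
  have hdiag : ∑ a : Fin n × Fin n, ∑ m : Fin n, ‖F (a.1, m) (m, a.2)‖ ^ 2 ≤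
      ∑ b, ∑ c, ‖F b c‖ ^ 2 := by
    calc ∑ a : Fin n × Fin n, ∑ m : Fin n, ‖F (a.1, m) (m, a.2)‖ ^ 2
        = ∑ κ : Fin n, ∑ ν : Fin n, ∑ m : Fin n, ‖F (κ, m) (m, ν)‖ ^ 2 := by
          rw [Fintype.sum_prod_type]
      _ = ∑ κ : Fin n, ∑ m : Fin n, ∑ ν : Fin n, ‖F (κ, m) (m, ν)‖ ^ 2 :=
          Finset.sum_congr rfl fun κ _ => Finset.sum_comm
      _ ≤ ∑ κ : Fin n, ∑ m : Fin n, ∑ c : Fin n × Fin n, ‖F (κ, m) c‖ ^ 2 := by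
          refine Finset.sum_le_sum fun κ _ => Finset.sum_le_sum fun m _ => ?_
          rw [Fintype.sum_prod_type (f := fun c : Fin n × Fin n => ‖F (κ, m) c‖ ^ 2)]
          exact Finset.single_le_sum (f := fun μ : Fin n => ∑ ν : Fin n, ‖F (κ, m) (μ, ν)‖ ^ 2)
            (fun μ _ => Finset.sum_nonneg fun ν _ => sq_nonneg _) (Finset.mem_univ m)
      _ = ∑ b : Fin n × Fin n, ∑ c : Fin n × Fin n, ‖F b c‖ ^ 2 := by
          rw [Fintype.sum_prod_type (f := fun b : Fin n × Fin n => ∑ c, ‖F b c‖ ^ 2)]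
  calc ∑ a : Fin n × Fin n, ‖∑ b, ∑ c, F b c * matMulTensor ℂ n n n a b c‖ ^ 2
      ≤ ∑ a : Fin n × Fin n, (n : ℝ) * ∑ m : Fin n, ‖F (a.1, m) (m, a.2)‖ ^ 2 :=
        Finset.sum_le_sum fun a _ => hrow a
    _ = (n : ℝ) * ∑ a : Fin n × Fin n, ∑ m : Fin n, ‖F (a.1, m) (m, a.2)‖ ^ 2 := by
        rw [Finset.mul_sum]
    _ ≤ (n : ℝ) * ∑ b, ∑ c, ‖F b c‖ ^ 2 := mul_le_mul_of_nonneg_left hdiag (Nat.cast_nonneg n)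

/-- The output slices `⟨n,n,n⟩(a,·,·)` are real, so pairing `conj F` instead of `F` against them does not
change the modulus: `|Σ_{b,c} conj F · T_a| = |Σ_{b,c} F · T_a|`. [folklore] -/
theorem sepMajorantSSL_norm_conj_slice {n : ℕ} (F : (Fin n × Fin n) → (Fin n × Fin n) → ℂ)
    (a : Fin n × Fin n) :
    ‖∑ b, ∑ c, conj (F b c) * matMulTensor ℂ n n n a b c‖ =
      ‖∑ b, ∑ c, F b c * matMulTensor ℂ n n n a b c‖ := by
  rw [sepMajorant_slice_sum_matMulTensor (fun b c => conj (F b c)) a,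
    sepMajorant_slice_sum_matMulTensor F a]
  have h : ∑ m : Fin n, conj (F (a.1, m) (m, a.2)) = conj (∑ m : Fin n, F (a.1, m) (m, a.2)) :=
    (map_sum _ _ _).symm
  rw [h, Complex.norm_conj]

/-- **Single-product law, normalised conjugate form.**  For `u, v ∈ ℂ^{n×n}` the product `conj u ⊗ conj v`
captures at most its own weight of `⟨n,n,n⟩`:
`(Σ_a |Σ_{b,c} conj (u b · v c) ⟨n,n,n⟩(a,b,c)|²) / (‖u‖² ‖v‖²) ≤ 1` (the quotient is `0` if `‖u‖²‖v‖² = 0`).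
[folklore] -/
theorem sepMajorantSSL_conjProduct_capture_le_one {n : ℕ} (u v : Fin n × Fin n → ℂ) :
    (∑ a : Fin n × Fin n, ‖∑ b, ∑ c, conj (u b * v c) * matMulTensor ℂ n n n a b c‖ ^ 2) /
        ((∑ b, ‖u b‖ ^ 2) * ∑ c, ‖v c‖ ^ 2) ≤ 1 := by
  refine div_le_one_of_le₀ ?_ (by positivity)
  have h := sepMajorant_singleProductLaw (fun b => conj (u b)) (fun c => conj (v c))
  simp only [Complex.norm_conj] at h
  simp_rw [map_mul]
  exact h

/-! #### The law -/

/-- **Spectral split law** (card `separable-majorant-law`, law (3)).  Let `S = Σ_{l<r} w_l ⊗ u_l ⊗ v_l`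
with `N_l = ‖u_l‖²‖v_l‖²`, and let `e_1..e_{d₁}, f_1..f_{d₂}` be an orthonormal system of
`ℂ^{n×n} ⊗ ℂ^{n×n}` (`⟨x,y⟩ = Σ conj x · y`) whose span contains every product `u_l ⊗ v_l`, such that the
normalised frame operator dominates `τ > 0` on `span e`:
`τ Σ_s |⟨e_s, y⟩|² ≤ Σ_l |⟨u_l ⊗ v_l, y⟩|² / N_l` for all `y`.  Then
`|⟨S, ⟨n,n,n⟩⟩|² ≤ (r/τ + n·d₂) · ‖S‖²` — the `τ`-dominated directions capture at most `r/τ` units of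
`⟨n,n,n⟩` (single-product law), the remaining `d₂` directions at most `n` each (flattening count).
Interpolates `stub_frameConditioningLaw` (`d₂ = 0`) and the flattening witness (`d₁ = 0`). [folklore] -/
theorem stub_spectralSplitLaw {n r d₁ d₂ : ℕ} (w u v : Fin r → Fin n × Fin n → ℂ)
    (e : Fin d₁ → Fin n × Fin n → Fin n × Fin n → ℂ) (f : Fin d₂ → Fin n × Fin n → Fin n × Fin n → ℂ)
    (τ : ℝ) (hτ : 0 < τ)
    (he : ∀ s t : Fin d₁, (∑ b, ∑ c, conj (e s b c) * e t b c) = if s = t then 1 else 0)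
    (hf : ∀ s t : Fin d₂, (∑ b, ∑ c, conj (f s b c) * f t b c) = if s = t then 1 else 0)
    (hef : ∀ (s : Fin d₁) (t : Fin d₂), (∑ b, ∑ c, conj (e s b c) * f t b c) = 0)
    (hspan : ∀ l : Fin r, ∃ (α : Fin d₁ → ℂ) (β : Fin d₂ → ℂ), ∀ b c,
      u l b * v l c = (∑ s, α s * e s b c) + ∑ t, β t * f t b c)
    (hdom : ∀ y : Fin n × Fin n → Fin n × Fin n → ℂ,
      τ * ∑ s, ‖∑ b, ∑ c, conj (e s b c) * y b c‖ ^ 2 ≤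
        ∑ l, ‖∑ b, ∑ c, conj (u l b * v l c) * y b c‖ ^ 2 / ((∑ b, ‖u l b‖ ^ 2) * ∑ c, ‖v l c‖ ^ 2)) :
    ‖∑ a, ∑ b, ∑ c, (∑ l, w l a * u l b * v l c) * matMulTensor ℂ n n n a b c‖ ^ 2 ≤
      ((r : ℝ) / τ + (n : ℝ) * (d₂ : ℝ)) * ∑ a, ∑ b, ∑ c, ‖∑ l, w l a * u l b * v l c‖ ^ 2 := by
  -- (0) coordinates of the products, the joint frame `g = (e, f)` and the slice coefficients `C a`
  choose α β hαβ using hspan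
  obtain ⟨g, hge, hgf⟩ : ∃ g : Fin d₁ ⊕ Fin d₂ → (Fin n × Fin n) → (Fin n × Fin n) → ℂ,
      (∀ s, g (Sum.inl s) = e s) ∧ ∀ t, g (Sum.inr t) = f t :=
    ⟨Sum.elim e f, fun _ => rfl, fun _ => rfl⟩
  obtain ⟨C, hCe, hCf⟩ : ∃ C : (Fin n × Fin n) → Fin d₁ ⊕ Fin d₂ → ℂ,
      (∀ a s, C a (Sum.inl s) = ∑ l, w l a * α l s) ∧ ∀ a t, C a (Sum.inr t) = ∑ l, w l a * β l t :=
    ⟨fun a => Sum.elim (fun s => ∑ l, w l a * α l s) (fun t => ∑ l, w l a * β l t),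
      fun _ _ => rfl, fun _ _ => rfl⟩
  obtain ⟨ζ, hζ⟩ : ∃ ζ : (Fin n × Fin n) → Fin d₁ ⊕ Fin d₂ → ℂ,
      ∀ a i, ζ a i = ∑ b, ∑ c, g i b c * matMulTensor ℂ n n n a b c := ⟨_, fun _ _ => rfl⟩
  have hg : ∀ i j, (∑ b, ∑ c, conj (g i b c) * g j b c) = if i = j then 1 else 0 :=
    sepMajorantSSL_jointFrame_orthonormal e f g hge hgf he hf hef
  -- the output slices `y_a = Σ_l w_l(a) · u_l ⊗ v_l = Σ_i C a i · g i`
  have hexp : ∀ a b c, (∑ l, w l a * u l b * v l c) = ∑ i, C a i * g i b c := by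
    intro a b c
    rw [Fintype.sum_sum_type]
    simp only [hge, hgf, hCe, hCf]
    calc ∑ l, w l a * u l b * v l c
        = ∑ l, ((∑ s, w l a * α l s * e s b c) + ∑ t, w l a * β l t * f t b c) := by
          refine Finset.sum_congr rfl fun l _ => ?_
          rw [mul_assoc, hαβ l b c, mul_add, Finset.mul_sum, Finset.mul_sum]
          simp only [mul_assoc]
      _ = (∑ s, ∑ l, w l a * α l s * e s b c) + ∑ t, ∑ l, w l a * β l t * f t b c := by
          rw [Finset.sum_add_distrib]
          congr 1 <;> exact Finset.sum_comm
      _ = (∑ s, (∑ l, w l a * α l s) * e s b c) + ∑ t, (∑ l, w l a * β l t) * f t b c := by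
          simp_rw [Finset.sum_mul]
  -- (1) the pairing slice by slice: `⟨S, ⟨n,n,n⟩⟩ = Σ_a Σ_i C a i · ζ a i`
  have hpair : (∑ a, ∑ b, ∑ c, (∑ l, w l a * u l b * v l c) * matMulTensor ℂ n n n a b c) =
      ∑ a, ∑ i, C a i * ζ a i := by
    refine Finset.sum_congr rfl fun a _ => ?_
    rw [sepMajorantSSL_frame_pairing g (C a) (fun b c => ∑ l, w l a * u l b * v l c)
      (matMulTensor ℂ n n n a) (hexp a)]
    exact Finset.sum_congr rfl fun i _ => by rw [hζ]
  -- (2) Parseval slice by slice: `‖S‖² = Σ_a Σ_i |C a i|²`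
  have hpars : (∑ a, ∑ b, ∑ c, ‖∑ l, w l a * u l b * v l c‖ ^ 2) = ∑ a, ∑ i, ‖C a i‖ ^ 2 :=
    Finset.sum_congr rfl fun a _ =>
      sepMajorantSSL_parseval g hg (C a) (fun b c => ∑ l, w l a * u l b * v l c) (hexp a)
  -- (3) `cap f ≤ n · d₂`: the flattening count, `‖f_t‖² = 1`
  have hfnorm : ∀ t, (∑ b, ∑ c, ‖f t b c‖ ^ 2) = 1 := by
    intro t
    have h := hf t t
    rw [if_pos rfl] at h
    simp_rw [Complex.conj_mul'] at h
    exact_mod_cast h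
  have hcapF : ∑ a : Fin n × Fin n, ∑ t, ‖∑ b, ∑ c, f t b c * matMulTensor ℂ n n n a b c‖ ^ 2 ≤
      (n : ℝ) * (d₂ : ℝ) := by
    rw [Finset.sum_comm]
    calc ∑ t, ∑ a : Fin n × Fin n, ‖∑ b, ∑ c, f t b c * matMulTensor ℂ n n n a b c‖ ^ 2
        ≤ ∑ t, (n : ℝ) * ∑ b, ∑ c, ‖f t b c‖ ^ 2 :=
          Finset.sum_le_sum fun t _ => sepMajorantSSL_sliceCapture_le (f t)
      _ = ∑ _t : Fin d₂, (n : ℝ) := Finset.sum_congr rfl fun t _ => by rw [hfnorm t, mul_one]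
      _ = (n : ℝ) * (d₂ : ℝ) := by
          rw [Finset.sum_const, Finset.card_univ, Fintype.card_fin, nsmul_eq_mul, mul_comm]
  -- (4) `τ · cap e ≤ r`: domination at `y = T_a`, summed over `a`, and the single-product law
  have hcapE : τ * ∑ a : Fin n × Fin n, ∑ s, ‖∑ b, ∑ c, e s b c * matMulTensor ℂ n n n a b c‖ ^ 2 ≤
      (r : ℝ) := by
    calc τ * ∑ a : Fin n × Fin n, ∑ s, ‖∑ b, ∑ c, e s b c * matMulTensor ℂ n n n a b c‖ ^ 2
        = ∑ a : Fin n × Fin n,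
            τ * ∑ s, ‖∑ b, ∑ c, conj (e s b c) * matMulTensor ℂ n n n a b c‖ ^ 2 := by
          rw [Finset.mul_sum]
          simp_rw [sepMajorantSSL_norm_conj_slice]
      _ ≤ ∑ a : Fin n × Fin n, ∑ l, ‖∑ b, ∑ c, conj (u l b * v l c) * matMulTensor ℂ n n n a b c‖ ^ 2 /
            ((∑ b, ‖u l b‖ ^ 2) * ∑ c, ‖v l c‖ ^ 2) :=
          Finset.sum_le_sum fun a _ => hdom (matMulTensor ℂ n n n a)
      _ = ∑ l, (∑ a : Fin n × Fin n,
            ‖∑ b, ∑ c, conj (u l b * v l c) * matMulTensor ℂ n n n a b c‖ ^ 2) /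
              ((∑ b, ‖u l b‖ ^ 2) * ∑ c, ‖v l c‖ ^ 2) := by
          rw [Finset.sum_comm]
          simp_rw [Finset.sum_div]
      _ ≤ ∑ _l : Fin r, (1 : ℝ) :=
          Finset.sum_le_sum fun l _ => sepMajorantSSL_conjProduct_capture_le_one (u l) (v l)
      _ = (r : ℝ) := by simp
  -- (3)+(4) the total capacity of the joint frame
  have hcap : ∑ a, ∑ i, ‖ζ a i‖ ^ 2 ≤ (r : ℝ) / τ + (n : ℝ) * (d₂ : ℝ) := by
    have hsplit : ∑ a, ∑ i, ‖ζ a i‖ ^ 2 =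
        (∑ a : Fin n × Fin n, ∑ s, ‖∑ b, ∑ c, e s b c * matMulTensor ℂ n n n a b c‖ ^ 2) +
          ∑ a : Fin n × Fin n, ∑ t, ‖∑ b, ∑ c, f t b c * matMulTensor ℂ n n n a b c‖ ^ 2 := by
      rw [← Finset.sum_add_distrib]
      refine Finset.sum_congr rfl fun a _ => ?_
      rw [Fintype.sum_sum_type]
      simp only [hζ, hge, hgf]
    rw [hsplit]
    refine add_le_add ?_ hcapF
    rw [le_div_iff₀ hτ, mul_comm]
    exact hcapE
  -- (5) Cauchy–Schwarz over `(a, i)` and assembly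
  have hCS : ‖∑ a, ∑ i, C a i * ζ a i‖ ^ 2 ≤ (∑ a, ∑ i, ‖C a i‖ ^ 2) * ∑ a, ∑ i, ‖ζ a i‖ ^ 2 :=
    sepMajorantSSL_cauchySchwarz_pair C ζ
  have hC0 : 0 ≤ ∑ a, ∑ i, ‖C a i‖ ^ 2 :=
    Finset.sum_nonneg fun a _ => Finset.sum_nonneg fun i _ => sq_nonneg _
  calc ‖∑ a, ∑ b, ∑ c, (∑ l, w l a * u l b * v l c) * matMulTensor ℂ n n n a b c‖ ^ 2
      = ‖∑ a, ∑ i, C a i * ζ a i‖ ^ 2 := by rw [hpair]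
    _ ≤ (∑ a, ∑ i, ‖C a i‖ ^ 2) * ∑ a, ∑ i, ‖ζ a i‖ ^ 2 := hCS
    _ ≤ (∑ a, ∑ i, ‖C a i‖ ^ 2) * ((r : ℝ) / τ + (n : ℝ) * (d₂ : ℝ)) :=
        mul_le_mul_of_nonneg_left hcap hC0
    _ = ((r : ℝ) / τ + (n : ℝ) * (d₂ : ℝ)) * ∑ a, ∑ b, ∑ c, ‖∑ l, w l a * u l b * v l c‖ ^ 2 := by
        rw [hpars, mul_comm]

end Summit.MatrixMultiplication.MatrixMultiplication.Theorems
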